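import Literature.NumberTheory.EllipticCurves.KodairaNeronUnramifiedTypeIVIndexProofs
import Literature.NumberTheory.EllipticCurves.InertiaFixedTorsionOfTamagawaProofs
import Literature.NumberTheory.DiophantineGeometry.ConductorExponentLeTwoProofs
import HarnessLib

/-!
# Kodaira types `IV`, `IV*` at `v ∤ 3`: an inertia-fixed `3`-torsion point OFF `E₀`, and `E[3]^{I_v}` is
# EXACTLY a line — without the hypothesis `3 ∣ c_v` (theorems only)

`Proofs` file (theorems only: no definition, no named fact, no instance), topic
`NumberTheory/EllipticCurves`.  The sibling `InertiaFixedTorsionOfTamagawaProofs` produces an inertia-fixed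
`p`-torsion point off `E₀` from `p ∣ c_v = [E(K_v) : E₀(K_v)]` (a `K_v`-RATIONAL point of order `p` in the
component group).  At a place of Kodaira type `IV` or `IV*` with `c_v = 1` (the Step-5 / Step-8 quadratic
irreducible over `k_v`: Frobenius swaps the two non-trivial components) that hypothesis fails although
`Φ_v(k̄) ≅ ℤ/3`.  Here the same Cauchy-element argument is run over `K_v^nr` instead of `K_v`: by
`index_nonsingularReductionSubgroup_map_eq_three_of_IV_or_IVstar` (`KodairaNeronUnramifiedTypeIVIndexProofs`)
the index `[J(K_v^nr) : E₀]` (`J = M ⊗ 𝒪ⁿʳ`, `M` the local minimal integral model) is EXACTLY `3`, so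
`J(K_v^nr)/E₀ ≅ ℤ/3` has an element `Q₀` of order `3`; `3 • Q₀ ∈ E₀(K_v^nr)` is `3 • Q'` with
`Q' ∈ E₀(K_v^nr)` (`exists_nsmul_eq_of_reducesToNonsingular_of_forall_inertia`: `E₀(K_v^nr)` is
`3`-divisible for `v ∤ 3`), and `R = Q₀ − Q'` is a `3`-torsion point of `E(K̄_v)` fixed by the inertia
group and NOT in `E₀` (Silverman *AEC* VII.6.1 over `K^nr`, proof of VII.7.1; Greenberg LNM 1716 p. 88:
"`c_v^{(p)} = |E(F_v)_p|`" at an additive place, here for `F_v = K_v^nr`).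

* `WeierstrassCurve.exists_torsion_three_not_reducesToNonsingular_of_kodairaSymbolAt` — LOCAL: for `E/K`
  over a number field, `v ∤ 3` of Kodaira type `IV` or `IV*`, `M = W.localMinimalIntegralModel v`,
  `V = (M ⊗ K_v) ⊗ K̄_v`: some `R ∈ V(K̄_v)` with `3 • R = O`, fixed by `I_𝔐`, `R ∉ E₀`.
* `WeierstrassCurve.exists_ne_zero_geomTorsion_three_absInertia_fixed_of_kodairaSymbolAt` — GLOBAL:
  some `P ∈ E[3] ≤ E(K̄)`, `P ≠ O`, fixed by `absInertia K_v` (through `absGaloisRestrict K K_v`).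
* `WeierstrassCurve.exists_line_geomTorsion_three_absInertia_fixed_of_kodairaSymbolAt` — with the bound
  "at most a line" of `InertiaFixedTorsionAdditiveIndexBoundProofs`: **at a place `v ∤ 3` of type `IV` or
  `IV*` the inertia-fixed points of `E[3]` form a subgroup of EXACTLY `3` elements**, whatever `c_v`.

Consumer (cell `bsd-ssimc`, crux `KobayashiLowerHalfLargeImage`, item stmt-BirchSwinnertonDyer-19001, line
`shadow_seed`): the `c_q = 1` branch (`q ≡ 1 (mod 3)`) of the line's local lemma, and — sequel file — the
Serre conductor exponent `a_v(E[3]) = 1` at EVERY place `v ∤ 6` of type `IV`/`IV*`.  Nothing is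
asserted about any curve; BSD is not proved by any of this.

## References

* [SilvermanAEC2009] J. H. Silverman, *The Arithmetic of Elliptic Curves*, 2nd ed. (2009): Props. VII.2.1,
  VII.2.2, VII.3.1, Thm. VII.6.1 and Cor. VII.6.2 (PDF p. 177), proof of Thm. VII.7.1 (PDF p. 179).
* [SilvermanATAEC1994] J. H. Silverman, *Advanced Topics* (1994), Cor. IV.9.2(d), IV.9.4 Steps 5, 8,
  Table 4.1 (PDF pp. 340–346, 365).
* [GreenbergLNM1716] R. Greenberg, *Iwasawa theory for elliptic curves*, LNM 1716 (1999), §3 p. 88.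
* [NeukirchANT1999] J. Neukirch, *Algebraic Number Theory* (1999), Ch. II Def. (9.10), Prop. (9.11).

Design: no definitions; one universe `u`; binders and local conventions as in
`KodairaNeronUnramifiedAdditiveBoundProofs` (steps (1)–(4) of
`exists_nsmul_reducesToNonsingular_le_four_of_hasAdditiveReduction`) and `InertiaFixedTorsionOfTamagawaProofs`.
-/

noncomputable section

open scoped Classical NNReal Pointwise
open NumberField IsDedekindDomain Field IsLocalRing

universe u

namespace WeierstrassCurve

open Literature.NumberTheory.EllipticCurves Literature.NumberTheory.EllipticCurves.LocalIndex
  Literature.NumberTheory.GaloisRepresentations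
  Literature.NumberTheory.GaloisRepresentations.IsNonarchimedeanLocalField
  Literature.NumberTheory.DiophantineGeometry Literature.NumberTheory.DiophantineGeometry.TateAlgorithm
  IsDedekindDomain.HeightOneSpectrum

variable {K : Type u} [Field K] [NumberField K] (W : WeierstrassCurve K) {v : HeightOneSpectrum (𝓞 K)}
  {w : Valuation (AlgebraicClosure (v.adicCompletion K)) ℝ≥0}
  (hw : ∀ x, (w x : ℝ) = spectralNorm (v.adicCompletion K) (AlgebraicClosure (v.adicCompletion K)) x)

include hw in
set_option maxHeartbeats 4000000 in
/-- **Types `IV`, `IV*` at `v ∤ 3`: an inertia-fixed `3`-torsion point off `E₀`.**  Let `E/K` be an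
elliptic curve over a number field, `v` a finite place with `3 ∉ v` whose Kodaira type is `IV` or `IV*`,
`M = W.localMinimalIntegralModel v`, `V = (M ⊗ K_v) ⊗ K̄_v`, `w = |·|_v` the spectral valuation and `𝔐`
the prime of `\bar 𝓞_v` above `𝓂_v`.  Then some `R ∈ V(K̄_v)` has `3 • R = O`, is fixed by every
`τ ∈ I_𝔐`, and does NOT reduce to a nonsingular point (in particular `R ≠ O`).  Proof: the index of `E₀` in
`J(K_v^nr)` (`J = M ⊗ 𝒪ⁿʳ`) is `3` (`index_nonsingularReductionSubgroup_map_eq_three_of_IV_or_IVstar`), so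
some `Q₀ ∈ J(K_v^nr) ∖ E₀` has `3 • Q₀ ∈ E₀`; read in `V` (steps (3)–(4) of
`exists_nsmul_reducesToNonsingular_le_four_of_hasAdditiveReduction`), `3 • Q₀ = 3 • Q'` with `Q' ∈ E₀`
inertia-fixed (`exists_nsmul_eq_of_reducesToNonsingular_of_forall_inertia`); `R = Q₀ − Q'`.
[cite: SilvermanAEC2009, Thm. VII.6.1 with Cor. VII.6.2 (PDF p. 177) and proof of Thm. VII.7.1 (PDF p. 179)]
[cite: SilvermanATAEC1994, Cor. IV.9.2(d) with Table 4.1 (PDF pp. 340, 365)] [cite: GreenbergLNM1716, §3 p. 88] -/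
theorem exists_torsion_three_not_reducesToNonsingular_of_kodairaSymbolAt [W.IsElliptic]
    {𝔐 : Ideal v.localAbsIntegers} (h𝔐 : 𝔐 ∈ v.localPrimesAbove) (h3v : (3 : 𝓞 K) ∉ v.asIdeal)
    (hT : W.kodairaSymbolAt v = .IV ∨ W.kodairaSymbolAt v = .IVstar) :
    ∃ R : (((W.localMinimalIntegralModel v).map (algebraMap (v.adicCompletionIntegers K)
        (v.adicCompletion K))).baseChange (AlgebraicClosure (v.adicCompletion K))).toAffine.Point,
      3 • R = 0 ∧
      (∀ τ ∈ 𝔐.inertia (absoluteGaloisGroup (v.adicCompletion K)),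
        Affine.Point.map ((absoluteGaloisGroup.toAlgEquiv (v.adicCompletion K) τ :
            AlgebraicClosure (v.adicCompletion K) ≃ₐ[v.adicCompletion K]
              AlgebraicClosure (v.adicCompletion K)) :
            AlgebraicClosure (v.adicCompletion K) →ₐ[v.adicCompletion K]
              AlgebraicClosure (v.adicCompletion K)) R = R) ∧
      ¬ ReducesToNonsingular w (IsLocalRing.residue w.integer) R := by
  haveI hV := isIntegral_spectralValuation_baseChange hw (W.localMinimalIntegralModel v)
  set M := W.localMinimalIntegralModel v with hM
  haveI := W.isElliptic_map_localMinimalIntegralModel (v := v)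
  haveI := W.isElliptic_baseChange_map_localMinimalIntegralModel (v := v)
  letI instDec : DecidableEq (maxUnramified (v.adicCompletion K)) := fun a b => Classical.propDecidable (a = b)
  haveI := isDiscreteValuationRing_unrIntegers hw
  haveI := henselianLocalRing_unrIntegers hw
  haveI : PerfectField (ResidueField (v.adicCompletionIntegers K)) := PerfectField.ofFinite
  have hv0 : w.Integers w.integer := Valuation.integer.integers w
  obtain ⟨φ, hφ⟩ := exists_ringHom_adicCompletionIntegers_unrIntegers hw
  obtain ⟨ψ, hψ⟩ := exists_ringHom_unrIntegers_integer (w := w)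
  have hvR := integers_valuationRing_valuation (Valuation.valuationSubring (Valuation.comap (algebraMap (maxUnramified (v.adicCompletion K)) (AlgebraicClosure (v.adicCompletion K))) w)) (maxUnramified (v.adicCompletion K))
  have hinjR := IsFractionRing.injective (Valuation.valuationSubring (Valuation.comap (algebraMap (maxUnramified (v.adicCompletion K)) (AlgebraicClosure (v.adicCompletion K))) w)) (maxUnramified (v.adicCompletion K))
  have hΔ : M.Δ ≠ 0 := localMinimalIntegralModel_Δ_ne_zero v W
  have hbad : ¬ W.HasGoodReductionAt v := by
    have hadd : W.HasAdditiveReductionAt v := (isAdditive_kodairaSymbolAt_iff_holds v W).mp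
      (by rcases hT with h | h <;> rw [h] <;> decide)
    exact hadd.not_hasGoodReductionAt
  have hs : M.kodairaSymbolOfMinimal = .IV ∨ M.kodairaSymbolOfMinimal = .IVstar := by
    rw [kodairaSymbolAt_def] at hT; exact hT
  /- (1) the index of `E₀` in `J(K_v^nr)`, `J = M ⊗ 𝒪ⁿʳ`, is `3`; an element of order `3` -/
  set H := ((M.map φ).nonsingularReductionSubgroup hvR) with hH
  have hidx : H.index = 3 := index_nonsingularReductionSubgroup_map_eq_three_of_IV_or_IVstar hw hφ M hΔ hs
  haveI hfinQ : Finite (((M.map φ).baseChange (maxUnramified (v.adicCompletion K))).toAffine.Point ⧸ H) :=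
    Nat.finite_of_card_ne_zero (by rw [← AddSubgroup.index_eq_card, hidx]; norm_num)
  obtain ⟨q, hq⟩ := exists_prime_addOrderOf_dvd_card'
    (G := ((M.map φ).baseChange (maxUnramified (v.adicCompletion K))).toAffine.Point ⧸ H) 3
    (by rw [← AddSubgroup.index_eq_card, hidx])
  obtain ⟨Q₀, rfl⟩ := QuotientAddGroup.mk_surjective q
  have hQ₀H : Q₀ ∉ H := fun h ↦ by
    have h1 : (QuotientAddGroup.mk Q₀ : _ ⧸ H) = 0 := (QuotientAddGroup.eq_zero_iff Q₀).mpr h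
    rw [h1, addOrderOf_zero] at hq
    norm_num at hq
  have h3Q₀H : 3 • Q₀ ∈ H := by
    refine (QuotientAddGroup.eq_zero_iff _).mp ?_
    rw [QuotientAddGroup.mk_nsmul, ← hq]
    exact addOrderOf_nsmul_eq_zero _
  /- (2) the models: `J ⊗ K_v^nr = X ⊗ K_v^nr`, `(J ⊗ 𝒪_w) ⊗ K̄_v = V`, `X = M ⊗ K_v` -/
  set X : WeierstrassCurve (v.adicCompletion K) := M.map (algebraMap (v.adicCompletionIntegers K) (v.adicCompletion K)) with hXdef
  have hJ : ((M.map φ).baseChange (maxUnramified (v.adicCompletion K))) = X.baseChange (maxUnramified (v.adicCompletion K)) := by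
    change (M.map φ).map (algebraMap _ _) =
      (M.map (algebraMap (v.adicCompletionIntegers K) (v.adicCompletion K))).map (algebraMap (v.adicCompletion K) (maxUnramified (v.adicCompletion K)))
    rw [WeierstrassCurve.map_map, WeierstrassCurve.map_map]
    congr 1
    refine RingHom.ext fun a ↦ Subtype.ext ?_
    change (((φ a : (Valuation.valuationSubring (Valuation.comap (algebraMap (maxUnramified (v.adicCompletion K)) (AlgebraicClosure (v.adicCompletion K))) w))) : (maxUnramified (v.adicCompletion K))) : (AlgebraicClosure (v.adicCompletion K))) = ((algebraMap (v.adicCompletion K) (maxUnramified (v.adicCompletion K)) (algebraMap (v.adicCompletionIntegers K) (v.adicCompletion K) a) : (maxUnramified (v.adicCompletion K))) : (AlgebraicClosure (v.adicCompletion K)))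
    rw [hφ, IntermediateField.coe_algebraMap_apply]
    rfl
  have hW₀ : (((M.map φ).map ψ).baseChange (AlgebraicClosure (v.adicCompletion K))) = X.baseChange (AlgebraicClosure (v.adicCompletion K)) := by
    change ((M.map φ).map ψ).map (algebraMap _ _) =
      (M.map (algebraMap (v.adicCompletionIntegers K) (v.adicCompletion K))).map (algebraMap (v.adicCompletion K) (AlgebraicClosure (v.adicCompletion K)))
    rw [WeierstrassCurve.map_map, WeierstrassCurve.map_map, WeierstrassCurve.map_map]
    congr 1
    refine RingHom.ext fun a ↦ ?_
    change ((ψ (φ a) : w.integer) : (AlgebraicClosure (v.adicCompletion K))) = algebraMap (v.adicCompletion K) (AlgebraicClosure (v.adicCompletion K)) (algebraMap (v.adicCompletionIntegers K) (v.adicCompletion K) a)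
    rw [hψ, hφ]
    rfl
  -- the residue field of `𝒪ⁿʳ` embeds into that of `𝒪_w`
  haveI hψloc : IsLocalHom ψ := ⟨fun a ha ↦ by
    by_contra hna
    have hmem : a ∈ maximalIdeal (Valuation.valuationSubring (Valuation.comap (algebraMap (maxUnramified (v.adicCompletion K)) (AlgebraicClosure (v.adicCompletion K))) w)) :=
      (IsLocalRing.mem_maximalIdeal _).mpr (mem_nonunits_iff.mpr hna)
    have := (map_mem_maximalIdeal_integer_iff hψ a).mpr hmem
    exact (mem_nonunits_iff.mp ((IsLocalRing.mem_maximalIdeal _).mp this)) ha⟩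
  have hκ : ((M.map φ).map ψ).map (residue w.integer) =
      (((M.map φ).map (residue (Valuation.valuationSubring (Valuation.comap (algebraMap (maxUnramified (v.adicCompletion K)) (AlgebraicClosure (v.adicCompletion K))) w)))).map
        (IsLocalRing.ResidueField.map ψ)) := by
    simp only [WeierstrassCurve.map_map]
    congr 1
  /- the maps on points: `J(K_v^nr) ≃ X(K_v^nr) → X(K̄_v) = V(K̄_v)` -/
  set e₁ := WeierstrassCurve.Affine.Point.congrEquiv hJ with he₁
  set ι : (X.baseChange (maxUnramified (v.adicCompletion K))).toAffine.Point →+ (X.baseChange (AlgebraicClosure (v.adicCompletion K))).toAffine.Point :=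
    WeierstrassCurve.Affine.Point.map (W' := X)
      (IsScalarTower.toAlgHom (v.adicCompletion K) (maxUnramified (v.adicCompletion K)) (AlgebraicClosure (v.adicCompletion K))) with hι
  -- (3) the image of `X(K_v^nr)` is fixed by `I_𝔐`
  have hfix : ∀ (Q : (X.baseChange (maxUnramified (v.adicCompletion K))).toAffine.Point),
      ∀ σ ∈ 𝔐.inertia (absoluteGaloisGroup (v.adicCompletion K)),
        WeierstrassCurve.Affine.Point.map
          ((absoluteGaloisGroup.toAlgEquiv _ σ : (AlgebraicClosure (v.adicCompletion K)) ≃ₐ[(v.adicCompletion K)] (AlgebraicClosure (v.adicCompletion K))) : (AlgebraicClosure (v.adicCompletion K)) →ₐ[(v.adicCompletion K)] (AlgebraicClosure (v.adicCompletion K))) (ι Q) = ι Q := by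
    intro Q σ hσ
    rcases Q with _ | ⟨x, y, h⟩
    · show WeierstrassCurve.Affine.Point.map _ (ι 0) = ι 0
      rw [map_zero, map_zero]
    · rw [hι, WeierstrassCurve.Affine.Point.map_some, WeierstrassCurve.Affine.Point.map_some]
      simp only [WeierstrassCurve.Affine.Point.some.injEq]
      exact ⟨(mem_maxUnramified_iff_forall_inertia hw h𝔐).mp x.2 σ hσ,
        (mem_maxUnramified_iff_forall_inertia hw h𝔐).mp y.2 σ hσ⟩
  -- (4) `E₀` of `J` over `𝒪ⁿʳ` corresponds to `E₀` of `X` over `𝒪_w` on the image of `J(K_v^nr)`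
  have hbridge : ∀ Q : (((M.map φ).baseChange (maxUnramified (v.adicCompletion K)))).toAffine.Point,
      ReducesToNonsingular w (residue w.integer) (ι (e₁ Q)) ↔ Q ∈ H := by
    intro Q
    rw [hH, WeierstrassCurve.mem_nonsingularReductionSubgroup_iff]
    rcases point_cases hvR Q with rfl | ⟨x, y, h, rfl, hx⟩ | ⟨a, b, h, rfl⟩
    · rw [map_zero, map_zero]
      exact iff_of_true reducesToNonsingular_zero hasNonsingularReduction_zero
    · have hx' : 1 < w (x : (AlgebraicClosure (v.adicCompletion K))) := not_le.mp fun hle ↦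
        (not_mem_range_iff hvR).mpr hx ⟨⟨x, (Valuation.mem_valuationSubring_iff _ _).mpr hle⟩, rfl⟩
      rw [he₁, WeierstrassCurve.Affine.Point.congrEquiv_some]
      exact iff_of_true (reducesToNonsingular_of_one_lt hx') (Or.inl ((not_mem_range_iff hvR).mpr hx))
    · rw [WeierstrassCurve.hasNonsingularReduction_some_algebraMap_iff hinjR h, he₁,
        WeierstrassCurve.Affine.Point.congrEquiv_some,
        ← (WeierstrassCurve.Affine.Point.congrEquiv hW₀).apply_symm_apply (ι _),
        reducesToNonsingular_congrEquiv_iff, reducesToNonsingular_iff_hasNonsingularReduction]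
      change ((M.map φ).map ψ).HasNonsingularReduction
        ((WeierstrassCurve.Affine.Point.congrEquiv hW₀).symm
          (WeierstrassCurve.Affine.Point.some _ _ _)) ↔ _
      rw [WeierstrassCurve.Affine.Point.congrEquiv_symm_some]
      constructor
      · rintro (hxr | ⟨a', b', ha', hb', hns⟩)
        · exact (hxr ⟨ψ a, hψ a⟩).elim
        · have ha'' : a' = ψ a := by
            apply hv0.hom_inj
            rw [ha']; exact (hψ a).symm
          have hb'' : b' = ψ b := by
            apply hv0.hom_inj
            rw [hb']; exact (hψ b).symm
          rw [ha'', hb'', hκ, ← IsLocalRing.ResidueField.map_residue,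
            ← IsLocalRing.ResidueField.map_residue] at hns
          exact (WeierstrassCurve.Affine.map_nonsingular _
            (IsLocalRing.ResidueField.map ψ).injective _ _).mp hns
      · intro hns
        refine Or.inr ⟨ψ a, ψ b, hψ a, hψ b, ?_⟩
        rw [hκ, ← IsLocalRing.ResidueField.map_residue, ← IsLocalRing.ResidueField.map_residue]
        exact (WeierstrassCurve.Affine.map_nonsingular _
          (IsLocalRing.ResidueField.map ψ).injective _ _).mpr hns
  /- (5) the point `P' = ι(e₁ Q₀)`, division of `3 • P'` in `E₀(K_v^nr)`, subtraction -/
  have hpunit' : ∀ {p : ℕ}, (p : 𝓞 K) ∉ v.asIdeal → IsUnit ((p : ℕ) : v.adicCompletionIntegers K) :=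
    fun {p} hpv ↦ by
      refine (LocalPoints.isUnit_iff_valuation_eq_one v (p : v.adicCompletionIntegers K)).mpr ?_
      have h1 := LocalPoints.valuation_natCast_eq_one (K := K) v hpv
      simpa using h1
  have hpunit : IsUnit ((3 : ℕ) : v.adicCompletionIntegers K) := hpunit' (by exact_mod_cast h3v)
  set P' := ι (e₁ Q₀) with hP'def
  have hP'fix : ∀ σ ∈ 𝔐.inertia (absoluteGaloisGroup (v.adicCompletion K)),
      WeierstrassCurve.Affine.Point.map
        ((absoluteGaloisGroup.toAlgEquiv _ σ : (AlgebraicClosure (v.adicCompletion K)) ≃ₐ[(v.adicCompletion K)] (AlgebraicClosure (v.adicCompletion K))) : (AlgebraicClosure (v.adicCompletion K)) →ₐ[(v.adicCompletion K)] (AlgebraicClosure (v.adicCompletion K))) P' = P' :=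
    fun σ hσ ↦ hfix _ σ hσ
  have h3P'E₀ : ReducesToNonsingular w (residue w.integer) (3 • P') := by
    have h := (hbridge (3 • Q₀)).mpr h3Q₀H
    rwa [map_nsmul, map_nsmul] at h
  have h3P'fix : ∀ σ ∈ 𝔐.inertia (absoluteGaloisGroup (v.adicCompletion K)),
      WeierstrassCurve.Affine.Point.map
        ((absoluteGaloisGroup.toAlgEquiv _ σ : (AlgebraicClosure (v.adicCompletion K)) ≃ₐ[(v.adicCompletion K)] (AlgebraicClosure (v.adicCompletion K))) : (AlgebraicClosure (v.adicCompletion K)) →ₐ[(v.adicCompletion K)] (AlgebraicClosure (v.adicCompletion K))) (3 • P') = 3 • P' :=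
    fun σ hσ ↦ by rw [map_nsmul, hP'fix σ hσ]
  obtain ⟨Q', hQ'E₀, hQ'I, hQ'3⟩ := W.exists_nsmul_eq_of_reducesToNonsingular_of_forall_inertia hw h𝔐 hbad
    hpunit h3P'E₀ h3P'fix
  have hE₀iff : ∀ T : (X.baseChange (AlgebraicClosure (v.adicCompletion K))).toAffine.Point,
      ReducesToNonsingular w (IsLocalRing.residue w.integer) T ↔
        ((M.map φ).map ψ).HasNonsingularReduction ((WeierstrassCurve.Affine.Point.congrEquiv hW₀).symm T) := fun T ↦ by
    rw [← reducesToNonsingular_iff_hasNonsingularReduction ((M.map φ).map ψ),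
      ← reducesToNonsingular_congrEquiv_iff w _ hW₀ ((WeierstrassCurve.Affine.Point.congrEquiv hW₀).symm T),
      AddEquiv.apply_symm_apply]
  refine ⟨P' - Q', ?_, fun τ hτ ↦ ?_, fun hR ↦ hQ₀H ?_⟩
  · rw [nsmul_sub, hQ'3, sub_self]
  · rw [map_sub, hP'fix τ hτ, hQ'I τ hτ]
  · have hP'E₀ : ReducesToNonsingular w (IsLocalRing.residue w.integer) P' := by
      refine (hE₀iff P').mpr ?_
      rw [show P' = (P' - Q') + Q' from (sub_add_cancel P' Q').symm, map_add]
      exact ((hE₀iff _).mp hR).add hv0 ((hE₀iff _).mp hQ'E₀)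
    exact (hbridge Q₀).mp hP'E₀

/-! ### The statements on `E[3] ≤ E(K̄)` -/

/-- `congrEquiv` along `X₁ = X₂` commutes with the Galois action on `K̄_v`-points (private plumbing, as
in `InertiaFixedTorsionOfTamagawaProofs`). [folklore] -/
private theorem congrEquiv_map_eq' {F : Type*} [Field F] {L : Type*} [Field L] [Algebra F L]
    {X₁ X₂ : WeierstrassCurve F} (h : X₁ = X₂) (h' : X₁.baseChange L = X₂.baseChange L)
    (σ : L →ₐ[F] L) (P : (X₁.baseChange L).toAffine.Point) :
    Affine.Point.congrEquiv h' (Affine.Point.map (W' := X₁) σ P) =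
      Affine.Point.map (W' := X₂) σ (Affine.Point.congrEquiv h' P) := by
  subst h; rfl

/-- **Types `IV`, `IV*` at `v ∤ 3` ⇒ a non-zero `3`-torsion point of `E(K̄)` fixed by the local inertia
group** (no hypothesis on `c_v`).  For an elliptic curve `E/K` over a number field and a finite place `v`
with `3 ∉ v` of Kodaira type `IV` or `IV*`, there is `P ∈ E[3] = geomTorsion W 3`, `P ≠ O`, fixed by
`absInertia K_v ≤ Γ_{K_v}` acting through `absGaloisRestrict K K_v` — the transport of
`exists_torsion_three_not_reducesToNonsingular_of_kodairaSymbolAt` along `E[3] ≅ E(K̄_v)[3]`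
(verbatim the transport of `exists_ne_zero_geomTorsion_absInertia_fixed_of_dvd_localTamagawaNumber`).
[cite: SilvermanAEC2009, Thm. VII.6.1 and Cor. VII.6.2 (PDF p. 177)] [cite: GreenbergLNM1716, §3 p. 88] -/
theorem exists_ne_zero_geomTorsion_three_absInertia_fixed_of_kodairaSymbolAt [W.IsElliptic]
    (h3v : (3 : 𝓞 K) ∉ v.asIdeal) (hT : W.kodairaSymbolAt v = .IV ∨ W.kodairaSymbolAt v = .IVstar) :
    ∃ P : geomPoints W, P ≠ 0 ∧ P ∈ geomTorsion W (3 : ℤ) ∧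
      ∀ σ ∈ absInertia (v.adicCompletion K), absGaloisRestrict K (v.adicCompletion K) σ • P = P := by
  obtain ⟨w, hw⟩ := v.exists_spectralValuation
  obtain ⟨𝔐, h𝔐⟩ := v.localPrimesAbove_nonempty
  set X := W.localMinimalModel v with hXdef
  haveI : X.IsElliptic := W.isElliptic_localMinimalModel v
  have hX₀K : (W.localMinimalIntegralModel v).baseChange (v.adicCompletion K) = X :=
    baseChange_integralModel_eq (v.adicCompletionIntegers K) X
  obtain ⟨R, h3R, hRI, hRE₀⟩ :=
    W.exists_torsion_three_not_reducesToNonsingular_of_kodairaSymbolAt hw h𝔐 h3v hT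
  have hR0 : R ≠ 0 := fun h ↦ hRE₀ (by rw [h]; exact reducesToNonsingular_zero)
  -- transport to `X ⊗ K̄_v`, then to `E(K̄_v) = localPoints`, then to `E(K̄)`
  have hVX : ((W.localMinimalIntegralModel v).baseChange (v.adicCompletion K)).baseChange
      (AlgebraicClosure (v.adicCompletion K)) = X.baseChange (AlgebraicClosure (v.adicCompletion K)) := by
    rw [hX₀K]
  set R₁ := Affine.Point.congrEquiv hVX R with hR₁
  obtain ⟨C, hC⟩ := W.exists_variableChange_smul_eq_localMinimalModel v
  obtain ⟨Φ, hΦ⟩ := W.exists_addEquiv_localPoints_of_smul_eq v hC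
  set Q₁ : localPoints W (v.adicCompletion K) := Φ.symm R₁ with hQ₁
  have hΦQ₁ : Φ Q₁ = R₁ := by rw [hQ₁, AddEquiv.apply_symm_apply]
  have h3R₁ : 3 • R₁ = 0 := by
    rw [hR₁]
    exact ((map_nsmul (Affine.Point.congrEquiv hVX) 3 R).symm.trans
      (congrArg (Affine.Point.congrEquiv hVX) h3R)).trans (map_zero _)
  have h3Q₁ : 3 • Q₁ = 0 := Φ.injective (by rw [map_nsmul, hΦQ₁, h3R₁, map_zero])
  have hQ₁I : ∀ σ ∈ absInertia (v.adicCompletion K), σ • Q₁ = Q₁ := by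
    intro σ hσ
    rw [← inertia_eq_absInertia hw h𝔐] at hσ
    apply Φ.injective
    rw [hΦ, hΦQ₁, hR₁]
    exact (congrEquiv_map_eq' hX₀K hVX _ R).symm.trans
      (congrArg (Affine.Point.congrEquiv hVX) (hRI σ hσ))
  obtain ⟨P₀, h3P₀, hP₀Q⟩ := exists_pointsMapOfEmb_eq_of_nsmul_eq_zero W
    (closureEmb (K := K) (v.adicCompletion K)) (by norm_num : (3 : ℕ) ≠ 0) h3Q₁
  refine ⟨P₀, fun h0' ↦ hR0 ?_, (mem_geomTorsion_iff W (3 : ℤ) P₀).mpr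
    (by rw [show (3 : ℤ) = ((3 : ℕ) : ℤ) from rfl, natCast_zsmul, h3P₀]), fun σ hσ ↦ ?_⟩
  · have hQ0 : Q₁ = 0 := by rw [← hP₀Q, h0', map_zero]
    have hR₁0 : Affine.Point.congrEquiv hVX R = 0 := by rw [← hR₁, ← hΦQ₁, hQ0, map_zero]
    exact (AddEquiv.map_eq_zero_iff (Affine.Point.congrEquiv hVX)).mp hR₁0
  · apply pointsMapOfEmb_injective W (closureEmb (K := K) (v.adicCompletion K))
    have hres : resGalOfEmb (closureEmb (K := K) (v.adicCompletion K)) σ =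
        absGaloisRestrict K (v.adicCompletion K) σ := rfl
    rw [← hres, pointsMapOfEmb_smul, hP₀Q, hQ₁I σ hσ]

/-- **At a place `v ∤ 3` of Kodaira type `IV` or `IV*`, `E[3]^{I_v}` is EXACTLY a line — whatever
`c_v`.**  For `E/K` elliptic over a number field and `v ∤ 3` of type `IV` or `IV*` there is a subgroup
`A ≤ E[3]` with `#A = 3`, fixed pointwise by `absInertia K_v`, containing every inertia-fixed point of
`E[3]`: existence from `exists_ne_zero_geomTorsion_three_absInertia_fixed_of_kodairaSymbolAt`, maximality
from `natCard_dvd_three_of_absInertia_fixed_of_hasAdditiveReductionAt` ("at most a line" at an additive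
place).  This removes the hypothesis `3 ∣ c_v` from
`exists_line_geomTorsion_three_absInertia_fixed_of_dvd_localTamagawaNumber` (types `IV`/`IV*` with
`c_v = 1` included: Frobenius then acts by `−1` on the line).
[cite: SilvermanAEC2009, Thm. VII.6.1 (PDF p. 177) and proof of Thm. VII.7.1 (PDF p. 179)]
[cite: SilvermanATAEC1994, Cor. IV.9.2(d) with Table 4.1 (PDF pp. 340, 365)] -/
theorem exists_line_geomTorsion_three_absInertia_fixed_of_kodairaSymbolAt [W.IsElliptic]
    (h3v : (3 : 𝓞 K) ∉ v.asIdeal) (hT : W.kodairaSymbolAt v = .IV ∨ W.kodairaSymbolAt v = .IVstar) :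
    ∃ A : AddSubgroup (geomPoints W), A ≤ geomTorsion W (3 : ℤ) ∧ Nat.card A = 3 ∧
      (∀ σ ∈ absInertia (v.adicCompletion K), ∀ P ∈ A,
        absGaloisRestrict K (v.adicCompletion K) σ • P = P) ∧
      ∀ P ∈ geomTorsion W (3 : ℤ), (∀ σ ∈ absInertia (v.adicCompletion K),
        absGaloisRestrict K (v.adicCompletion K) σ • P = P) → P ∈ A := by
  haveI : PerfectField (IsLocalRing.ResidueField (v.adicCompletionIntegers K)) :=
    PerfectField.ofFinite
  have hadd : W.HasAdditiveReductionAt v := (isAdditive_kodairaSymbolAt_iff_holds v W).mp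
    (by rcases hT with h | h <;> rw [h] <;> decide)
  obtain ⟨P₀, hP₀0, hP₀3, hP₀I⟩ :=
    W.exists_ne_zero_geomTorsion_three_absInertia_fixed_of_kodairaSymbolAt h3v hT
  -- the subgroup of ALL inertia-fixed `3`-torsion points has `≤ 3` elements and contains `⟨P₀⟩`
  set F : AddSubgroup (geomPoints W) :=
    { carrier := {P | P ∈ geomTorsion W (3 : ℤ) ∧ ∀ σ ∈ absInertia (v.adicCompletion K),
        absGaloisRestrict K (v.adicCompletion K) σ • P = P}
      add_mem' := fun {a b} ha hb ↦ ⟨(geomTorsion W (3 : ℤ)).add_mem ha.1 hb.1,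
        fun σ hσ ↦ by rw [smul_add, ha.2 σ hσ, hb.2 σ hσ]⟩
      zero_mem' := ⟨(geomTorsion W (3 : ℤ)).zero_mem, fun σ _ ↦ smul_zero _⟩
      neg_mem' := fun {a} ha ↦ ⟨(geomTorsion W (3 : ℤ)).neg_mem ha.1,
        fun σ hσ ↦ by rw [smul_neg, ha.2 σ hσ]⟩ } with hFdef
  have hFle : F ≤ geomTorsion W (3 : ℤ) := fun P hP ↦ hP.1
  have hFcard : Nat.card F ∣ 3 :=
    W.natCard_dvd_three_of_absInertia_fixed_of_hasAdditiveReductionAt hadd h3v F hFle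
      (fun σ hσ P hP ↦ hP.2 σ hσ)
  have hP₀F : P₀ ∈ F := ⟨hP₀3, hP₀I⟩
  have hzle : AddSubgroup.zmultiples P₀ ≤ F := AddSubgroup.zmultiples_le_of_mem hP₀F
  have hp3P₀ : 3 • P₀ = 0 := by
    have h := (mem_geomTorsion_iff W (3 : ℤ) P₀).mp hP₀3
    rwa [show (3 : ℤ) = ((3 : ℕ) : ℤ) from rfl, natCast_zsmul] at h
  have hcardz : Nat.card (AddSubgroup.zmultiples P₀) = 3 := by
    rw [Nat.card_zmultiples, addOrderOf_eq_prime hp3P₀ hP₀0]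
  haveI : Finite F := Nat.finite_of_card_ne_zero (fun h ↦ by
    rw [h] at hFcard; exact absurd (Nat.eq_zero_of_zero_dvd hFcard) (by norm_num))
  have hFcard3 : Nat.card F = 3 :=
    le_antisymm (Nat.le_of_dvd (by norm_num) hFcard)
      (hcardz ▸ AddSubgroup.card_le_of_le hzle)
  have hzF : AddSubgroup.zmultiples P₀ = F :=
    AddSubgroup.eq_of_le_of_card_ge hzle (by rw [hFcard3, hcardz])
  exact ⟨F, hFle, hFcard3, fun σ hσ P hP ↦ hP.2 σ hσ, fun P hP hPI ↦ ⟨hP, hPI⟩⟩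

end WeierstrassCurve

end
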